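import Summits.HodgeConjecture.HodgeConjecture.Theorems.GenericDivisibilityHodgeClassesGenericallyDivisibleFinite
import Literature.AlgebraicGeometry.HodgeTheory.ZariskiOpenHOneFiniteness

/-!
# Route GenericDivisibility — crux `HodgeClassesGenericallyDivisible` (C1, item stmt-HodgeConjecture-18466):
# the surface case `p = 1` granted ONLY `TorsionDiesGenerically`

Companion to `Theorems/GenericDivisibilityHodgeClassesGenericallyDivisibleFinite`, whose `p = 1`
theorems (`genericDivisibility_exists_restrict_eq_zero_surface`, `hodgeClassesGenericallyDivisible_one`,
`hodgeClassesGenericallyDivisible_one_of_facts`) carry the hypothesis `hfin`: finite generation of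
`H₁((X ∖ Z)(ℂ); ℤ)` for the Zariski opens of the surface (Dimca 1992, Ch. 1 Cor. (6.10), vendored as the
named fact `Dimca1992_finite_singularHomology_complexPointsCompl`).  That hypothesis is now a THEOREM of
the tree in the degree the surface case needs
(`Literature.AlgebraicGeometry.HodgeTheory.finite_singularHomology_one_complexPointsCompl`, file
`HodgeTheory/ZariskiOpenHOneFiniteness`: irreducible components, straightening off codimension `2`,
the topological Thom class in the critical degree over `ℤ`, homological semipurity, Mayer–Vietoris),
so this file records, sorry-free:

* `genericDivisibility_uct_surface` — **`hUCT` in degree `2` is unconditional**: on the complex points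
  of a Zariski open of a smooth projective complex surface, an integral class of degree `2` with
  vanishing complexification is killed by some `N ≥ 1` (universal coefficients, Hatcher Thm. 3.2).
* `genericDivisibility_exists_restrict_eq_zero_surface_of_torsionDiesGenerically` /
  `hodgeClassesGenericallyDivisible_one_of_torsionDiesGenerically` — **C1 at `p = 1` follows from the
  route's support item `TorsionDiesGenerically` alone** (stmt-HodgeConjecture-18850 = Colliot-Thélène–
  Voisin 2012 Thm. 3.1, the only remaining input; the Hodge conjecture for surfaces is the tree's
  theorem `hodgeConjectureFor_of_dim_le_three_holds`, Lefschetz `(1,1)`): an integral class with `(1,1)`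
  complexification on a smooth projective complex surface restricts to `0` — so is `m • 0` for every
  `m ≥ 1` — on the complex points of some non-empty Zariski open.
* `hodgeClassesGenericallyDivisible_one_of_colliotTheleneVoisin` — the same granted the single printed
  theorem `ColliotTheleneVoisin2012_torsionDiesGenerically` (trust base: one registered named fact).

The crux itself (all `p ≥ 1`) is untouched: for `p ≥ 2` it is of Hodge-conjecture strength.

References: A. Dimca, *Singularities and Topology of Hypersurfaces* (1992), Ch. 1 Cor. (6.10)
[Dimca1992]; J.-L. Colliot-Thélène, C. Voisin, Duke Math. J. 161 (2012), Thm. 3.1 and §4.1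
[ColliotTheleneVoisin2012]; C. Voisin, *Hodge Theory I* (2002), Thm. 11.30 [VoisinHodgeI2002];
A. Hatcher, *Algebraic Topology* (2002), §3.1 Thm. 3.2 [HatcherAT2002].
-/

-- `Summit.HodgeConjecture.HodgeConjecture.Theorems` is the mandated namespace (single-problem summit:
-- Problem = Summit), which `linter.dupNamespace` flags on every declaration; the lakefile turns the
-- linter off tree-wide (weak option), restated here so stand-alone elaboration is warning-free too.
set_option linter.dupNamespace false

noncomputable section

namespace Summit.HodgeConjecture.HodgeConjecture.Theorems

open CategoryTheory AlgebraicGeometry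
open Literature.AlgebraicGeometry.Motives Literature.AlgebraicGeometry.HodgeTheory
  Literature.AlgebraicTopology.SingularHomology
open Summit.HodgeConjecture.HodgeConjecture.Theses.GenericDivisibility

/-! ### `hUCT` in degree `2` is unconditional -/

/-- **Universal coefficients on the Zariski opens of a surface, unconditionally.** For `X` a smooth
projective complex surface, `Z ⊆ X` Zariski-closed and `w ∈ H²((X ∖ Z)(ℂ); ℤ)` with `w ⊗ 1 = 0` in
`H²((X ∖ Z)(ℂ); ℂ)`, some `N ≥ 1` kills `w`: `H₁((X ∖ Z)(ℂ); ℤ)` is finitely generated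
(`finite_singularHomology_one_complexPointsCompl`, Dimca 1992 Cor. (6.10) in degree one, proved in the
tree), so `Ext(H₁, ℤ)` is torsion (Hatcher Thm. 3.2;
`genericDivisibility_exists_nsmul_eq_zero_of_ringChange_eq_zero`).
[cite: HatcherAT2002, §3.1 Thm. 3.2 and p. 196] [cite: Dimca1992, Ch. 1 Cor. (6.10)] -/
theorem genericDivisibility_uct_surface ⦃X : SchemeOver ℂ⦄ (hX : IsSmoothProjective (2 * 1) X)
    (Z : Set X.left) (hZ : IsClosed Z) (w : singularCohomology ℤ ℤ (complexPointsCompl X Z) (2 * 1))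
    (hw : singularCohomology.ringChange (Int.castRingHom ℂ) (complexPointsCompl X Z) (2 * 1) w = 0) :
    ∃ N : ℕ, 1 ≤ N ∧ N • w = 0 := by
  haveI := finite_singularHomology_one_complexPointsCompl hX hZ
  exact genericDivisibility_exists_nsmul_eq_zero_of_ringChange_eq_zero (k := 1) (by norm_num) w hw

/-! ### C1 at `p = 1` from `TorsionDiesGenerically` alone -/

/-- **Integral `(1,1)` classes on a surface die on a non-empty Zariski open, granted only
`TorsionDiesGenerically`.** For `X` smooth projective of dimension `2` over `ℂ` and
`z ∈ H²(X(ℂ); ℤ)` with `(1,1)` complexification there is a proper Zariski-closed `Z` with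
`z|_{(X ∖ Z)(ℂ)} = 0`: `genericDivisibility_exists_restrict_eq_zero_surface` (Lefschetz `(1,1)` for the
surface, proved in the tree, puts `z ⊗ 1` in `N¹`; off the support `z|` has vanishing complexification,
is torsion by universal coefficients, and dies on a smaller open by `TorsionDiesGenerically`) with its
finite-generation hypothesis discharged by `finite_singularHomology_one_complexPointsCompl`.
[cite: VoisinHodgeI2002, Thm. 11.30] [cite: ColliotTheleneVoisin2012, Thm 3.1 and §4.1]
[cite: Dimca1992, Ch. 1 Cor. (6.10)] -/
theorem genericDivisibility_exists_restrict_eq_zero_surface_of_torsionDiesGenerically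
    (hT : TorsionDiesGenerically) {X : SchemeOver ℂ} (hX : IsSmoothProjective (2 * 1) X)
    (z : singularCohomology ℤ ℤ (ComplexPoints X) (2 * 1))
    (hz : IsOfHodgeType (2 * 1) X (2 * 1) 1 1
      (singularCohomology.ringChange (Int.castRingHom ℂ) (ComplexPoints X) (2 * 1) z)) :
    ∃ Z : Set X.left, IsClosed Z ∧ Z ≠ Set.univ ∧
      singularCohomology.map ℤ ℤ
        (⟨Subtype.val, continuous_subtype_val⟩ : C(complexPointsCompl X Z, ComplexPoints X))
        (2 * 1) z = 0 :=
  genericDivisibility_exists_restrict_eq_zero_surface hT hX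
    (fun _ hZ _ ↦ finite_singularHomology_one_complexPointsCompl hX hZ) z hz

/-- **The `p = 1` instance of `HodgeClassesGenericallyDivisible`, granted only the route's support item
`TorsionDiesGenerically`** (stmt-HodgeConjecture-18850, Colliot-Thélène–Voisin 2012 Thm. 3.1 — the one
remaining input of the surface case): for `X` a smooth projective complex surface, `z ∈ H²(X(ℂ); ℤ)` with
`(1,1)` complexification and every `m ≥ 1`, there are a proper Zariski-closed `Z` and `y` (namely `0`)
on `(X ∖ Z)(ℂ)` with `m • y = z|_{(X ∖ Z)(ℂ)}`. The item's `∀ p ≥ 1` statement specialised to `p = 1`,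
verbatim. [cite: VoisinHodgeI2002, Thm. 11.30] [cite: ColliotTheleneVoisin2012, Thm 3.1 and §4.1]
[cite: Dimca1992, Ch. 1 Cor. (6.10)] -/
theorem hodgeClassesGenericallyDivisible_one_of_torsionDiesGenerically (hT : TorsionDiesGenerically)
    ⦃X : SchemeOver ℂ⦄ (hX : IsSmoothProjective (2 * 1) X)
    (z : singularCohomology ℤ ℤ (ComplexPoints X) (2 * 1))
    (hz : IsOfHodgeType (2 * 1) X (2 * 1) 1 1
      (singularCohomology.ringChange (Int.castRingHom ℂ) (ComplexPoints X) (2 * 1) z))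
    (m : ℕ) (hm : 1 ≤ m) :
    ∃ Z : Set X.left, IsClosed Z ∧ Z ≠ Set.univ ∧
      ∃ y : singularCohomology ℤ ℤ (complexPointsCompl X Z) (2 * 1),
        m • y = singularCohomology.map ℤ ℤ
          (⟨Subtype.val, continuous_subtype_val⟩ : C(complexPointsCompl X Z, ComplexPoints X))
          (2 * 1) z :=
  hodgeClassesGenericallyDivisible_one hT
    (fun _ hX _ hZ _ ↦ finite_singularHomology_one_complexPointsCompl hX hZ) hX z hz m hm

/-- **C1 at `p = 1` granted the single printed theorem Colliot-Thélène–Voisin 2012 Thm. 3.1** (the named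
fact `ColliotTheleneVoisin2012_torsionDiesGenerically`, torsion-freeness of the Zariski sheaf `𝓗²(ℤ)`;
classically Kummer theory / Hilbert 90, CT–Voisin §4.1): no finite-generation and no Hodge-conjecture
input remain. [cite: ColliotTheleneVoisin2012, Thm 3.1 and §4.1] [cite: VoisinHodgeI2002, Thm. 11.30] -/
theorem hodgeClassesGenericallyDivisible_one_of_colliotTheleneVoisin
    (hT : ColliotTheleneVoisin2012_torsionDiesGenerically)
    ⦃X : SchemeOver ℂ⦄ (hX : IsSmoothProjective (2 * 1) X)
    (z : singularCohomology ℤ ℤ (ComplexPoints X) (2 * 1))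
    (hz : IsOfHodgeType (2 * 1) X (2 * 1) 1 1
      (singularCohomology.ringChange (Int.castRingHom ℂ) (ComplexPoints X) (2 * 1) z))
    (m : ℕ) (hm : 1 ≤ m) :
    ∃ Z : Set X.left, IsClosed Z ∧ Z ≠ Set.univ ∧
      ∃ y : singularCohomology ℤ ℤ (complexPointsCompl X Z) (2 * 1),
        m • y = singularCohomology.map ℤ ℤ
          (⟨Subtype.val, continuous_subtype_val⟩ : C(complexPointsCompl X Z, ComplexPoints X))
          (2 * 1) z :=
  hodgeClassesGenericallyDivisible_one_of_torsionDiesGenerically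
    (genericDivisibility_torsionDiesGenerically_of_colliotTheleneVoisin hT) hX z hz m hm

/-- **Registered sub-goal `stub_hodgeClassesGenericallyDivisible_one` of the crux item
stmt-HodgeConjecture-18466** — its `p = 1` sector granted only `TorsionDiesGenerically`, in the
registered arrow shape (the item's statement with `p` specialised to `1`, behind the route item
`TorsionDiesGenerically`); the proof is `hodgeClassesGenericallyDivisible_one_of_torsionDiesGenerically`.
[cite: VoisinHodgeI2002, Thm. 11.30] [cite: ColliotTheleneVoisin2012, Thm 3.1 and §4.1]
[cite: Dimca1992, Ch. 1 Cor. (6.10)] -/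
theorem stub_hodgeClassesGenericallyDivisible_one :
    TorsionDiesGenerically → ∀ ⦃X : SchemeOver ℂ⦄, IsSmoothProjective (2 * 1) X →
      ∀ z : singularCohomology ℤ ℤ (ComplexPoints X) (2 * 1),
        IsOfHodgeType (2 * 1) X (2 * 1) 1 1
          (singularCohomology.ringChange (Int.castRingHom ℂ) (ComplexPoints X) (2 * 1) z) →
        ∀ m : ℕ, 1 ≤ m → ∃ Z : Set X.left, IsClosed Z ∧ Z ≠ Set.univ ∧
          ∃ y : singularCohomology ℤ ℤ (complexPointsCompl X Z) (2 * 1),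
            m • y = singularCohomology.map ℤ ℤ
              (⟨Subtype.val, continuous_subtype_val⟩ : C(complexPointsCompl X Z, ComplexPoints X))
              (2 * 1) z :=
  fun hT _ hX z hz m hm ↦ hodgeClassesGenericallyDivisible_one_of_torsionDiesGenerically hT hX z hz m hm

end Summit.HodgeConjecture.HodgeConjecture.Theorems

end
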